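import Summits.AtomisticToContinuum.Crystallization.Theorems.FrustratedLawDichotomyCellTailsRem
import Summits.AtomisticToContinuum.Crystallization.Theorems.FrustratedLawDichotomyCoherentFloorHaloDial

/-!
# FrustratedLawDichotomy · crux `AperiodicFrustratedLawGap` (stmt-AtomisticToContinuum-27623) — CELL-SOUND V: THE CLASS-H TWIN IN THE LABEL FRAME
(cell decomp-a2c, lens-5 g113; continues `…CellTailsRem`; transfers (hand-1) `…CoherentFloorHaloDial`)

The class-H rows of the atlas (a wall / D-boundary site: the coherent window is the HALO WINDOW `closedBall 0 Rc ∩ {⟪z,n⟫ ≤ s}` of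
(hand-1) `…CoherentFloorHalo`, the matter beyond the plane is unknown `7/10`-hard-core matter) use hand-1's door
`certFloorHalo_le_two_mul_rootEnergy_dial_of_nash` (per-site clearance dials `dB, dH`; the same five booked columns as T2 with the far
force column `‖y x‖·(farCol (dB x) + halfCol (dH x))` and the extra energy column `halfEnergyCol s`).  This file is its LABEL-FRAME twin,
parallel to `…CellFrame` for class A, so that ONE K-file format (label lists + certified numbers, `…CellTailsRem.lb_le_certFloorL_trunc`)
serves both row classes:

1. `labOf`, `certFloorHL` — label dials transported to `E3`, and the label-frame HALO certificate floor.
2. `certFloorHalo_image_eq` — hand-1's halo floor of the placed template `M.image pos` equals `certFloorHL` (positions injective on `M`).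
3. ★ `certFloorHL_le_two_mul_rootEnergy_of_nash` — T2-H in the label frame (NASH clause (e) verbatim,
   `μ ∈ coherentOn (M.image pos) τ (haloWindow n s Rc)`).
4. ★★ `lb_le_certFloorHL_trunc` — the truncated master for class H: the class-A hypothesis list of `lb_le_certFloorL_trunc` with the far
   column replaced by certified numbers `fch m ≥ ‖Y m‖·(farCol (dB m) + halfCol (dH m))` and one more number `hE ≥ halfEnergyCol s`.
5. ★ `rowFloorHalo_of_cells`, `measurableSet_rowHalo` — row packaging for (228) `…AtlasDoor` (`hfloor` clause on
   `⋃_{F ∈ B} coherentOn (M.image (posF F)) τ (haloWindow (nF F) (sF F) Rc)`, normal and plane offset may vary over the cell) and the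
   measurability of such a row for countable `B` (`hK` clause).

House conventions: SI units · italic scalars, bold vectors, sans-serif tensors · numbered formulae only when referenced · en-dash for
ranges · References = cited works, numbered, alphabetical · no footnotes; Remarks at section ends · British spelling, -ise · Lennard-Jones
hyphenated; NASH capitalised as the Statement's notion · "folklore" tags standard bookkeeping; no new references are cited in this file.
-/

noncomputable section

namespace Summit.AtomisticToContinuum.Crystallization.Theorems.FrustratedLawDichotomyCellHalo

open MeasureTheory Metric Set RealInnerProductSpace
open scoped BigOperators
open Literature.MathematicalPhysics.StatisticalMechanics (lennardJones rootEnergy)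
open Literature.Probability.Process (IsRootedHardCore)
open Summit.AtomisticToContinuum.Crystallization.Theorems.ChargedEnergyGapNegative (E3)
open Summit.AtomisticToContinuum.Crystallization.Theorems.FrustratedLawDichotomyCoherentSets (coherentAt)
open Summit.AtomisticToContinuum.Crystallization.Theorems.FrustratedLawDichotomyCoherentOn (coherentOn measurableSet_coherentOn)
open Summit.AtomisticToContinuum.Crystallization.Theorems.FrustratedLawDichotomyCoherentFloorAlgebra
open Summit.AtomisticToContinuum.Crystallization.Theorems.FrustratedLawDichotomyCoherentFloor
open Summit.AtomisticToContinuum.Crystallization.Theorems.FrustratedLawDichotomyCoherentFloorHalo (haloWindow halfCol halfEnergyCol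
  measurableSet_haloWindow)
open Summit.AtomisticToContinuum.Crystallization.Theorems.FrustratedLawDichotomyCoherentFloorHaloDial
  (certFloorHalo_le_two_mul_rootEnergy_dial_of_nash)
open Summit.AtomisticToContinuum.Crystallization.Theorems.FrustratedLawDichotomyCertFloorTails
open Summit.AtomisticToContinuum.Crystallization.Theorems.FrustratedLawDichotomyCertFloorTailsRem
open Summit.AtomisticToContinuum.Crystallization.Theorems.FrustratedLawDichotomyCertFloorTailsEnergy
open Summit.AtomisticToContinuum.Crystallization.Theorems.FrustratedLawDichotomyCellFrame
open Summit.AtomisticToContinuum.Crystallization.Theorems.FrustratedLawDichotomyCellTails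
open Summit.AtomisticToContinuum.Crystallization.Theorems.FrustratedLawDichotomyCellTailsRem (lb_le_certFloorL_trunc)

variable {ι : Type*} [DecidableEq ι]

/-! ## §1. Label dials and the label-frame HALO certificate floor -/

/-- A label-indexed scalar dial `f` on the interior labels `MI` transported to `E3` along the placement `pos`:
`labOf MI pos f (pos m) = f m` for `m ∈ MI` (positions injective), `0` off the interior template. -/
def labOf (MI : Finset ι) (pos : ι → E3) (f : ι → ℝ) (x : E3) : ℝ := ∑ m ∈ MI, if pos m = x then f m else 0

/-- ★ THE LABEL-FRAME HALO CERTIFICATE FLOOR: the left-hand side of (hand-1) `certFloorHalo_le_two_mul_rootEnergy_dial_of_nash` written over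
the label sets `M ∋ o` (template), `MI ⊆ M` (interior), positions `pos` (`pos o = 0`), label multipliers `Y`, label clearance dials `dB, dH`
(ball / plane) and the plane offset `s`: `certFloorL` with the far force column `‖Y m‖·(farCol (dB m) + halfCol (dH m))` and the extra
energy column `halfEnergyCol s`. -/
def certFloorHL (M MI : Finset ι) (o : ι) (pos Y : ι → E3) (τ Rc : ℝ) (dB dH : ι → ℝ) (s : ℝ) : ℝ :=
  ∑ m ∈ M.erase o, (phiT (‖pos m‖ ^ 2) - (τ ^ 2 * secondNeg ‖pos m‖ + energyRem ‖pos m‖ τ))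
    - τ * ∑ m ∈ M.erase o, ‖psiT (‖pos m‖ ^ 2) • pos m - certCoeffL M MI pos Y m‖
    - ∑ m ∈ MI, ⟪Y m, ∑ m' ∈ M.erase m, ljBondForce (pos m - pos m')⟫
    - ∑ m ∈ MI, ‖Y m‖ * (farCol (dB m) + halfCol (dH m))
    - 1 / 2 * ∑ m ∈ M, ∑ m' ∈ M.erase m, ‖YE MI Y m - YE MI Y m'‖ * forceRem ‖pos m - pos m'‖ (dispL o τ m + dispL o τ m')
    - tailCol Rc - halfEnergyCol s

/-- `certFloorHL` versus `certFloorL`: only the far force column changes and `halfEnergyCol s` is subtracted. [folklore] -/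
theorem certFloorHL_eq (M MI : Finset ι) (o : ι) (pos Y : ι → E3) (τ Rc : ℝ) (dB dH : ι → ℝ) (s : ℝ) :
    certFloorHL M MI o pos Y τ Rc dB dH s = certFloorL M MI o pos Y τ Rc + ∑ m ∈ MI, ‖Y m‖ * farCol (Rc - (‖pos m‖ + τ))
      - ∑ m ∈ MI, ‖Y m‖ * (farCol (dB m) + halfCol (dH m)) - halfEnergyCol s := by
  unfold certFloorHL certFloorL
  ring

/-- hand-1's halo floor versus (226)'s `certFloor`: the same relation on the `E3` side. [folklore] -/
theorem haloFloor_eq (a I : Finset E3) (y : E3 → E3) (τ Rc : ℝ) (dB dH : E3 → ℝ) (s : ℝ) :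
    ∑ x ∈ a.erase 0, (phiT (‖x‖ ^ 2) - (τ ^ 2 * secondNeg ‖x‖ + energyRem ‖x‖ τ))
        - τ * ∑ z ∈ a.erase 0, ‖psiT (‖z‖ ^ 2) • z - certCoeff a I y z‖
        - ∑ x ∈ I, ⟪y x, ∑ x' ∈ a.erase x, ljBondForce (x - x')⟫
        - ∑ x ∈ I, ‖y x‖ * (farCol (dB x) + halfCol (dH x))
        - 1 / 2 * ∑ x ∈ a, ∑ x' ∈ a.erase x, ‖mulExt I y x - mulExt I y x'‖ * forceRem ‖x - x'‖ (dispB τ x + dispB τ x')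
        - tailCol Rc - halfEnergyCol s
      = certFloor a I y τ Rc + ∑ x ∈ I, ‖y x‖ * farCol (Rc - (‖x‖ + τ)) - ∑ x ∈ I, ‖y x‖ * (farCol (dB x) + halfCol (dH x))
        - halfEnergyCol s := by
  unfold certFloor
  ring

/-! ## §2. The frame change for the halo floor -/

section Frame

variable {M MI : Finset ι} {o : ι} {pos Y : ι → E3}

omit [DecidableEq ι] in
/-- `labOf` recovers the label dial at an interior template point. [folklore] -/
theorem labOf_pos (hinj : Set.InjOn pos ↑M) (hMI : MI ⊆ M) (f : ι → ℝ) {m : ι} (hm : m ∈ MI) : labOf MI pos f (pos m) = f m := by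
  unfold labOf
  rw [Finset.sum_eq_single_of_mem m hm]
  · rw [if_pos rfl]
  · intro m' hm' hne
    rw [if_neg]
    exact fun h => hne (hinj (hMI hm') (hMI hm) h)

/-- ★ hand-1's halo floor of the placed template, with multipliers `mulOf MI pos Y` and dials `labOf MI pos dB`, `labOf MI pos dH`, equals the
label-frame halo floor `certFloorHL` (positions injective on `M`, `o ∈ M`, `pos o = 0`, `MI ⊆ M`). [folklore] -/
theorem certFloorHalo_image_eq (hinj : Set.InjOn pos ↑M) (ho : o ∈ M) (h0 : pos o = 0) (hMI : MI ⊆ M) (τ Rc : ℝ) (dB dH : ι → ℝ)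
    (s : ℝ) :
    ∑ x ∈ (M.image pos).erase 0, (phiT (‖x‖ ^ 2) - (τ ^ 2 * secondNeg ‖x‖ + energyRem ‖x‖ τ))
        - τ * ∑ z ∈ (M.image pos).erase 0, ‖psiT (‖z‖ ^ 2) • z - certCoeff (M.image pos) (MI.image pos) (mulOf MI pos Y) z‖
        - ∑ x ∈ MI.image pos, ⟪mulOf MI pos Y x, ∑ x' ∈ (M.image pos).erase x, ljBondForce (x - x')⟫
        - ∑ x ∈ MI.image pos, ‖mulOf MI pos Y x‖ * (farCol (labOf MI pos dB x) + halfCol (labOf MI pos dH x))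
        - 1 / 2 * ∑ x ∈ M.image pos, ∑ x' ∈ (M.image pos).erase x,
            ‖mulExt (MI.image pos) (mulOf MI pos Y) x - mulExt (MI.image pos) (mulOf MI pos Y) x'‖
              * forceRem ‖x - x'‖ (dispB τ x + dispB τ x')
        - tailCol Rc - halfEnergyCol s
      = certFloorHL M MI o pos Y τ Rc dB dH s := by
  classical
  rw [haloFloor_eq, certFloor_image_eq hinj ho h0 hMI, certFloorHL_eq]
  have t4 : ∑ x ∈ MI.image pos, ‖mulOf MI pos Y x‖ * farCol (Rc - (‖x‖ + τ)) = ∑ m ∈ MI, ‖Y m‖ * farCol (Rc - (‖pos m‖ + τ)) := by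
    rw [Finset.sum_image (injOn_sub hinj hMI)]
    exact Finset.sum_congr rfl fun m hm => by rw [mulOf_pos hinj hMI hm]
  have t4' : ∑ x ∈ MI.image pos, ‖mulOf MI pos Y x‖ * (farCol (labOf MI pos dB x) + halfCol (labOf MI pos dH x))
      = ∑ m ∈ MI, ‖Y m‖ * (farCol (dB m) + halfCol (dH m)) := by
    rw [Finset.sum_image (injOn_sub hinj hMI)]
    exact Finset.sum_congr rfl fun m hm => by rw [mulOf_pos hinj hMI hm, labOf_pos hinj hMI dB hm, labOf_pos hinj hMI dH hm]
  rw [t4, t4']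

end Frame

/-! ## §3. ★ T2-H in the label frame, the truncated master for class H, and the row packaging -/

/-- ★★ **T2-H IN THE LABEL FRAME.**  For a rooted `7/10`-hard-core `μ` satisfying the NASH clause (e) verbatim and coherent (tolerance `τ`)
with the placed template `M.image pos` on the HALO WINDOW `closedBall 0 Rc ∩ {⟪z,n⟫ ≤ s}` (`‖n‖ = 1`, `1 ≤ s`; `o ∈ M` the root label,
`pos o = 0`, interior labels `MI ⊆ M`, placed labels `2τ`-separated and inside the halo window with their `τ`-balls, interior dials
`7/20 ≤ dB m ≤ Rc − (‖pos m‖ + τ)`, `7/20 ≤ dH m ≤ s − (⟪pos m, n⟫ + τ)`): `certFloorHL … ≤ 2·rootEnergy V_LJ μ` for ANY label multipliers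
`Y`.  Transfer of (hand-1) `certFloorHalo_le_two_mul_rootEnergy_dial_of_nash` along `certFloorHalo_image_eq`. [folklore] -/
theorem certFloorHL_le_two_mul_rootEnergy_of_nash {μ : Measure E3} {τ Rc s : ℝ} {n : E3} (M MI : Finset ι) (o : ι) (pos Y : ι → E3)
    (dB dH : ι → ℝ) (hn : ‖n‖ = 1) (hs : 1 ≤ s) (hμ : IsRootedHardCore (7 / 10) μ)
    (hNash : ∀ p : E3, μ {p} ≠ 0 → ∀ w : E3, (∀ q : E3, μ {q} ≠ 0 → q ≠ p → w ≠ q) →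
      ∑' q : {q : E3 // μ {q} ≠ 0 ∧ q ≠ p}, lennardJones (dist p (q : E3)) ≤
        ∑' q : {q : E3 // μ {q} ≠ 0 ∧ q ≠ p}, lennardJones (dist w (q : E3)))
    (hτ0 : 0 ≤ τ) (hτ : 2 * τ < 7 / 10) (hRc : 1 ≤ Rc) (hcoh : μ ∈ coherentOn (M.image pos) τ (haloWindow n s Rc))
    (ho : o ∈ M) (h0 : pos o = 0) (hMI : MI ⊆ M)
    (hsep : ∀ m ∈ M, ∀ m' ∈ M, m ≠ m' → 2 * τ < dist (pos m) (pos m'))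
    (hin : ∀ m ∈ M, ‖pos m‖ + τ ≤ Rc ∧ ⟪pos m, n⟫ + τ ≤ s)
    (hI : ∀ m ∈ MI, (7 / 20 ≤ dB m ∧ dB m ≤ Rc - (‖pos m‖ + τ)) ∧ (7 / 20 ≤ dH m ∧ dH m ≤ s - (⟪pos m, n⟫ + τ))) :
    certFloorHL M MI o pos Y τ Rc dB dH s ≤ 2 * rootEnergy lennardJones μ := by
  classical
  have hinj : Set.InjOn pos ↑M := by
    intro m hm m' hm' h
    by_contra hne
    have h1 := hsep m hm m' hm' hne
    rw [h, dist_self] at h1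
    linarith
  rw [← certFloorHalo_image_eq hinj ho h0 hMI]
  refine certFloorHalo_le_two_mul_rootEnergy_dial_of_nash _ _ _ hn hs hμ hNash hτ0 hτ hRc hcoh (Finset.mem_image.2 ⟨o, ho, h0⟩)
    (Finset.image_subset_image hMI) ?_ ?_ ?_
  · intro x hx x' hx' hne
    obtain ⟨m, hm, rfl⟩ := Finset.mem_image.1 hx
    obtain ⟨m', hm', rfl⟩ := Finset.mem_image.1 hx'
    exact hsep m hm m' hm' fun h => hne (by rw [h])
  · intro x hx
    obtain ⟨m, hm, rfl⟩ := Finset.mem_image.1 hx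
    exact hin m hm
  · intro x hx
    obtain ⟨m, hm, rfl⟩ := Finset.mem_image.1 hx
    rw [labOf_pos hinj hMI dB hm, labOf_pos hinj hMI dH hm]
    exact hI m hm

section Trunc

variable {M MI : Finset ι} {pos Y : ι → E3}

/-- ★★ **THE TRUNCATED MASTER FOR CLASS H** = the hypothesis list a class-H cell K-file's soundness lemma discharges: verbatim the class-A
list of `…CellTailsRem.lb_le_certFloorL_trunc` (label side conditions of the lists `MN nb ML nbr nbh`, radii `L_N R_N L_D L_R Lh`, certified
numbers `host deb nn hf RM SY tc`) with the far force numbers `fch m ≥ ‖Y m‖·(farCol (dB m) + halfCol (dH m))` in place of `fc` and one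
more number `hE ≥ halfEnergyCol s`; conclusion
`Σhost − (Σ_{ML}deb + debTail) − τ(Σ_{MN}nn + T0_δ(R_N) + 2·SY·TL_δ(L_N)) − Σhf − Σfch − (RM + SY·remTail) − tc − hE ≤ certFloorHL`.
[folklore] -/
theorem lb_le_certFloorHL_trunc (o : ι) {τ Rc δ L_N R_N L_D L_R s : ℝ} {dB dH : ι → ℝ} (hτ0 : 0 ≤ τ) (hδ : 0 < δ)
    (hsep : ∀ z ∈ M, ∀ z' ∈ M, z ≠ z' → δ ≤ dist (pos z) (pos z')) (hMI : MI ⊆ M)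
    -- NASH column: near sites `MN`, near bonds `nb`
    (MN : Finset ι) (nb : ι → Finset ι) (hLN : δ / 2 ≤ L_N) (hRN : δ / 2 ≤ R_N)
    (hnb : ∀ z ∈ M, ∀ x ∈ M, x ≠ z → x ∉ nb z → L_N ≤ dist (pos x) (pos z)) (hMN : MN ⊆ M.erase o)
    (hMNc : ∀ m ∈ M.erase o, m ∉ MN → R_N ≤ ‖pos m‖ ∧ m ∉ MI ∧ ∀ x ∈ MI, x ∉ nb m)
    -- root-bond debits: near-root list `ML`
    (ML : Finset ι) (hLD : δ / 2 ≤ L_D) (hτD : τ < L_D) (hML : ML ⊆ M.erase o) (hMLc : ∀ m ∈ M.erase o, m ∉ ML → L_D ≤ ‖pos m‖)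
    -- force remainder: near-pair lists `nbr`
    (nbr : ι → Finset ι) (hLR : δ / 2 ≤ L_R) (hτR : 2 * τ < L_R)
    (hnbr : ∀ m ∈ M, ∀ m' ∈ M, m' ≠ m → m' ∉ nbr m → L_R ≤ dist (pos m') (pos m))
    -- host-force pairings: near lists `nbh`, radii `Lh`
    (nbh : ι → Finset ι) (Lh : ι → ℝ) (hLh : ∀ m ∈ MI, δ / 2 ≤ Lh m)
    (hnbh : ∀ m ∈ MI, ∀ m' ∈ M, m' ≠ m → m' ∉ nbh m → Lh m ≤ dist (pos m') (pos m))
    -- the certified numbers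
    (host : ι → ℝ) (hhost : ∀ m ∈ M.erase o, host m ≤ phiT (‖pos m‖ ^ 2))
    (deb : ι → ℝ) (hdeb : ∀ m ∈ ML, τ ^ 2 * secondNeg ‖pos m‖ + energyRem ‖pos m‖ τ ≤ deb m)
    (nn : ι → ℝ) (hnn : ∀ m ∈ MN, ‖psiT (‖pos m‖ ^ 2) • pos m - certCoeffNearL M MI pos Y nb m‖ ≤ nn m)
    (hf : ι → ℝ) (hhf : ∀ m ∈ MI, ⟪Y m, ∑ m' ∈ (M.erase m).filter (fun m' => m' ∈ nbh m), ljBondForce (pos m - pos m')⟫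
      + ‖Y m‖ * psiTail δ (Lh m) ≤ hf m)
    (fch : ι → ℝ) (hfch : ∀ m ∈ MI, ‖Y m‖ * (farCol (dB m) + halfCol (dH m)) ≤ fch m)
    (RM : ℝ) (hRM : 1 / 2 * ∑ m ∈ M, ∑ m' ∈ (M.erase m).filter (fun m' => m' ∈ nbr m),
      ‖YE MI Y m - YE MI Y m'‖ * forceRem ‖pos m - pos m'‖ (dispL o τ m + dispL o τ m') ≤ RM)
    (SY : ℝ) (hSY : ∑ x ∈ MI, ‖Y x‖ ≤ SY) (tc : ℝ) (htc : tailCol Rc ≤ tc) (hE : ℝ) (hhE : halfEnergyCol s ≤ hE) :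
    ∑ m ∈ M.erase o, host m - (∑ m ∈ ML, deb m + debTail δ L_D τ)
        - τ * (∑ m ∈ MN, nn m + psiTail δ R_N + 2 * SY * linTail δ L_N)
        - ∑ m ∈ MI, hf m - ∑ m ∈ MI, fch m - (RM + SY * remTail δ L_R τ) - tc - hE
      ≤ certFloorHL M MI o pos Y τ Rc dB dH s := by
  have h := lb_le_certFloorL_trunc (M := M) (MI := MI) (pos := pos) (Y := Y) (Rc := Rc) o hτ0 hδ hsep hMI MN nb hLN hRN hnb hMN hMNc
    ML hLD hτD hML hMLc nbr hLR hτR hnbr nbh Lh hLh hnbh host hhost deb hdeb nn hnn hf hhf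
    (fun m => ‖Y m‖ * farCol (Rc - (‖pos m‖ + τ))) (fun m _ => le_rfl) RM hRM SY hSY tc htc
  have hF := Finset.sum_le_sum hfch
  rw [certFloorHL_eq]
  linarith

end Trunc

/-- ★ ROW PACKAGING FOR THE ATLAS DOOR, CLASS H.  A class-H cell is a family of placements `posF F`, label multipliers `YF F`, unit normals
`nF F`, plane offsets `sF F ≥ 1` and label dials `dBF F, dHF F` over a parameter set `B`; if every placement is admissible (root label at `0`,
`2τ`-separated, `τ`-balls inside the halo window, interior dials in range) and CERTIFIED (`2(cUp + mc) ≤ certFloorHL`), then on the row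
`⋃_{F ∈ B} coherentOn (M.image (posF F)) τ (haloWindow (nF F) (sF F) Rc)` every rooted `7/10`-hard-core Nash configuration has
`c + mc ≤ rootEnergy` (`c ≤ cUp`) — the `hfloor` clause of (228) `…AtlasDoor.aperiodicFrustratedLawGap_of_atlas` for this row. [folklore] -/
theorem rowFloorHalo_of_cells {κ : Type*} (B : Set κ) (M MI : Finset ι) (o : ι) (posF YF : κ → ι → E3) (nF : κ → E3) (sF : κ → ℝ)
    (dBF dHF : κ → ι → ℝ) {τ Rc c mc : ℝ} (hτ0 : 0 ≤ τ) (hτ : 2 * τ < 7 / 10) (hRc : 1 ≤ Rc) (ho : o ∈ M) (hMI : MI ⊆ M)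
    (hn : ∀ F ∈ B, ‖nF F‖ = 1) (hs : ∀ F ∈ B, 1 ≤ sF F) (h0 : ∀ F ∈ B, posF F o = 0)
    (hsep : ∀ F ∈ B, ∀ m ∈ M, ∀ m' ∈ M, m ≠ m' → 2 * τ < dist (posF F m) (posF F m'))
    (hin : ∀ F ∈ B, ∀ m ∈ M, ‖posF F m‖ + τ ≤ Rc ∧ ⟪posF F m, nF F⟫ + τ ≤ sF F)
    (hI : ∀ F ∈ B, ∀ m ∈ MI, (7 / 20 ≤ dBF F m ∧ dBF F m ≤ Rc - (‖posF F m‖ + τ)) ∧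
      (7 / 20 ≤ dHF F m ∧ dHF F m ≤ sF F - (⟪posF F m, nF F⟫ + τ)))
    {cUp : ℝ} (hc : c ≤ cUp) (hcert : ∀ F ∈ B, 2 * (cUp + mc) ≤ certFloorHL M MI o (posF F) (YF F) τ Rc (dBF F) (dHF F) (sF F))
    (μ : Measure E3) (hμ : IsRootedHardCore (7 / 10) μ)
    (hNash : ∀ p : E3, μ {p} ≠ 0 → ∀ w : E3, (∀ q : E3, μ {q} ≠ 0 → q ≠ p → w ≠ q) →
      ∑' q : {q : E3 // μ {q} ≠ 0 ∧ q ≠ p}, lennardJones (dist p (q : E3)) ≤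
        ∑' q : {q : E3 // μ {q} ≠ 0 ∧ q ≠ p}, lennardJones (dist w (q : E3)))
    (hrow : μ ∈ ⋃ F ∈ B, coherentOn (M.image (posF F)) τ (haloWindow (nF F) (sF F) Rc)) :
    c + mc ≤ rootEnergy lennardJones μ := by
  obtain ⟨F, hF, hcoh⟩ := Set.mem_iUnion₂.1 hrow
  have h := certFloorHL_le_two_mul_rootEnergy_of_nash M MI o (posF F) (YF F) (dBF F) (dHF F) (hn F hF) (hs F hF) hμ hNash hτ0 hτ hRc
    hcoh ho (h0 F hF) hMI (hsep F hF) (hin F hF) (hI F hF)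
  linarith [hcert F hF]

omit [DecidableEq ι] in
/-- The class-H row over a countable parameter set is measurable (the `hK` clause of (228)). [folklore] -/
theorem measurableSet_rowHalo {κ : Type*} {B : Set κ} (hB : B.Countable) (M : Finset ι) (posF : κ → ι → E3) (nF : κ → E3)
    (sF : κ → ℝ) (τ Rc : ℝ) : MeasurableSet (⋃ F ∈ B, coherentOn (M.image (posF F)) τ (haloWindow (nF F) (sF F) Rc)) :=
  MeasurableSet.biUnion hB fun _ _ => measurableSet_coherentOn _ _ (measurableSet_haloWindow _ _ _)

omit [DecidableEq ι] in
/-- The class-A row over a countable parameter set is measurable (the `hK` clause of (228); `coherentAt = coherentOn … (closedBall 0 Rc)`).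
[folklore] -/
theorem measurableSet_row {κ : Type*} {B : Set κ} (hB : B.Countable) (M : Finset ι) (posF : κ → ι → E3) (τ Rc : ℝ) :
    MeasurableSet (⋃ F ∈ B, coherentAt (M.image (posF F)) τ Rc) :=
  MeasurableSet.biUnion hB fun _ _ => measurableSet_coherentOn _ _ measurableSet_closedBall

end Summit.AtomisticToContinuum.Crystallization.Theorems.FrustratedLawDichotomyCellHalo

end
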